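/-
Copyright (c) 2026 the pub-hodgecm-mathlib formalisation cell (harness21).  Prover seat hodgecm-mathlib-LH4-p11 (g9), req620 Track A «(D-RAM) FOUR-FRAME» squad, helper lane on
h413 = stmt-HodgeConjecture-24833 (count-neutral).  β-BOARD v1 (sub-dealer LH4-p05 (g8) LEDGER #13) ROW R6a «THE PER-LATTICE κ-CLASS READ OF TOWER 1», FILE B: the per-orbit VALUE
on the glued representative in abstract-indicator form, and the two indicators by the `u ↦ u⁻¹` reduction to LH4-p17 (g0)'s ★ R3 FILE 3.  Proof pattern = LH7-p06 (g0)'s ★ (β1).  2026-09-04.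
-/
import Summits.HodgeConjecture.HodgeConjecture.Theorems.F0P3cDyRamLabelledOddKappaClassGluedRep    -- ★ p861745 (this seat): FILE A `valueClassLabel_glued_rep_class_kappaLocus_iff_character`; brings ★ p13 (L-lab-20c), ★ LH4-p17 GluedCharacter, ★ κG-A1∕A2
import Summits.HodgeConjecture.HodgeConjecture.Theorems.F0P3cDyRamLabelledOddBoundaryValueG3       -- ★ p861675 (LH7-p06 (g0)): `normSign_one_add_mul_mul`; brings ★ p861456 HEAD A′-χ, ★ p860316, ★ (L-lab-20b) `classSign_mul_eq_of_label`
import Summits.HodgeConjecture.HodgeConjecture.Theorems.F0P3cDyRamDiagonalKappaGluedClassForm       -- ★ κG-A1 (LH4-p09 lineage): `isVertexLattice_zero_latt_glued_rep`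
import HarnessLib

/-!
# Crux `H413`, line LH4 «(D-RAM) FOUR-FRAME» — (β-BAL) Stage B, β-BOARD ROW R6a «THE κ-CLASSES OF TOWER 1, PER LATTICE», FILE B: the labelled odd VALUE of the glued
# representative `latt V(1,1,g)` at the κ-locus, `= ε(g)·ω(D(g)_i)∕2 · [∀ u ∈ S_F, ω(u_i)·μ_c(u) = 1] · stabiliserWeight`, and the indicators `[ω₀μ ≡ 1] = [2d ≤ ρ + 2k + 1]`,
# `[ω₁μ ≡ 1] = [2d ≤ ρ + 1]`

Cell `hodgecm-mathlib` (D-0151), FLOOR 0, crux item H413 = `stmt-HodgeConjecture-24833`, route `HCCMUnconditional`; squad F0∕P3c∕LH4.  THEOREMS ONLY (no `def`, no instance, no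
notation, no `sorry`, default heartbeats); ★-only imports; lane `--supports stmt-HodgeConjecture-24833 --as helper` (count-neutral); pays NO row, states NO law.
WHAT.  ★ p861745 FILE A reads the value-class label of the class `D(g)·u` on `latt V(1,1,g)` at the κ-locus (`2ρ + ℓ₀ = n₂`, `2(ρ+t′+k) + ℓ₀ = n₁`, `k ≥ 1`) as `ε(g)·μ_c(u)`,
`ε(g) = ω(g·e_A·(1+r))`, `μ_c(u) = ω(u₀)·ω(1 + (u₁∕u₀ − 1)·c)`, `r = e_B·π₀^{t′+k}∕(g·e_A)` (`|r| = |ϖ|^{2k}`), `c = r∕(1+r)`.  §1 HEAD **`labelledOddCount_div_relIndex_glued_rep_kappaLocus`**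
feeds it to ★ p861456 `labelledOddCount_div_relIndex_eq_of_character` (LH4-p17 (g0)): `μ_c` is `{±1}`-valued, MULTIPLICATIVE on `S_F(latt V)` (`u₁∕u₀ ∈ U^{[ρ]}` there, ★
`ratios_of_mem_fixedUnitStabilizer_glued_rep`; ★ `normSign_one_add_mul_mul` at depth `r = ρ` with `|ϖ^ρ c| < 1` and `|ϖ^{2ρ}|·|c| ≤ |ϖ|^{2d−1}` — `2ρ ≥ 2d − 1` at the κ-locus), and
trivial on `N(S̃′)` (torus-equivariance of the label, ★ `classSign_mul_eq_of_label`, as in ★ (β1)); so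
`labelledOddCount σ ϖ 0 i Λ (latt V) ∕ [𝒰 : N(S̃′)] = ε(g)·ω(D(g)_i)∕2 · [∀ u ∈ S_F(latt V), ω(u_i)·μ_c(u) = 1] · stabiliserWeight σ (latt V)`.
§2 THE INDICATORS by the involution `u ↦ u⁻¹` of `S_F` (which exchanges `u₁∕u₀` and `u₀∕u₁` and fixes `ω(u_j)`): **`forall_normSign_zero_mul_kappaChar_iff`**
`[∀ u, ω(u₀)·μ_c(u) = 1] ↔ 2d ≤ ρ + 2k + 1` (★ LH4-p17 `forall_normSign_one_mul_gluedChar_iff` on the inverted variable; `|c| = |ϖ|^{2k}` exactly) and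
**`forall_normSign_one_mul_kappaChar_iff`** `[∀ u, ω(u₁)·μ_c(u) = 1] ↔ 2d ≤ ρ + 1` (★ `forall_normSign_zero_mul_gluedChar_iff`).  Slot `2` is the sequel (it sees `u₂∕u₁ ∈ U^{[ρ+2t′]}` and
`ω(D(g)₂) = ω(−(1+g))`).  PER ORBIT, OWN SLOT `0`: `ε(g)·ω(D(g)₀) = ω(e_A)·ω(1+r(g))` — summed over the `g`-transversal this is LH4-cdis1 (g0)'s boundary factor `F(n₁ − n₂ − s)` (R6b).
HONEST LABEL.  Count-neutral (`--supports`); nothing printed is asserted; R6b (orbit∕stratum∕family sums, LH4-p08 (g10)), slot 2, hRest, (β) `stub_law_cleanSgn`, T₊ remain OPEN; `HC_CM` is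
proved only modulo the 7 printed citations (2 remaining named inputs: hLiu418 = `stmt-HodgeConjecture-24832`, h413 = `stmt-HodgeConjecture-24833`) until rung 0 closes.
References: [Kottwitz1986BaseChangeUnits] §1 pp. 240–241 · [Rogawski1990] §4.9 Prop. 4.9.1 (a)(b) p. 55, §4.10 p. 58 · [LanglandsShelstad1987] §3 · [Serre1979] Ch. V §3 Cor. 3, Ch. XV §2.
-/

set_option autoImplicit false

noncomputable section

namespace Summit.HodgeConjecture.HodgeConjecture.Cruxes.H413.F0P3cDyRamLabelledOddKappaClassValueG1

open Matrix WithZero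
open Literature.NumberTheory.Automorphic Literature.NumberTheory.Automorphic.HermitianLattice Literature.NumberTheory.Automorphic.UnitaryGroup
open Literature.NumberTheory.Automorphic.UnitaryLatticeTree Literature.NumberTheory.Automorphic.UnitaryThreeFourFrame
open Literature.NumberTheory.LocalFields Literature.NumberTheory.LocalFields.WildQuadraticDatum
open Summit.HodgeConjecture.HodgeConjecture.Cruxes.H413.F0P3cDyRamFourFramePieces
open Summit.HodgeConjecture.HodgeConjecture.Cruxes.H413.F0P3cDyRamFourFrameCensusDefs
open Summit.HodgeConjecture.HodgeConjecture.Cruxes.H413.F0P3cDyRamStageOneBDefs (mcOfRecord)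
open Summit.HodgeConjecture.HodgeConjecture.Cruxes.H413.F0P3cDyRamDiagonalTorusDefs
open Summit.HodgeConjecture.HodgeConjecture.Cruxes.H413.F0P3cDyRamLabelledOddCountDefs
open Summit.HodgeConjecture.HodgeConjecture.Cruxes.H413.F0P3cDyRamStableSumSignClasses (normSign_eq_one_or)
open Summit.HodgeConjecture.HodgeConjecture.Cruxes.H413.F0P3cDyRamDiagonalOrbitFibreTransport (fibre_isCoset_zero)
open Summit.HodgeConjecture.HodgeConjecture.Cruxes.H413.F0P3cDyRamDiagonalKappaGluedClassForm (isVertexLattice_zero_latt_glued_rep)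
open Summit.HodgeConjecture.HodgeConjecture.Cruxes.H413.F0P3cDyRamLabelledOddGluedCharacter
open Summit.HodgeConjecture.HodgeConjecture.Cruxes.H413.F0P3cDyRamLabelledOddKappaClassGluedRep (valueClassLabel_glued_rep_class_kappaLocus_iff_character)
open Summit.HodgeConjecture.HodgeConjecture.Cruxes.H413.F0P3cDyRamLabelledOddBoundaryValueG3 (normSign_one_add_mul_mul)
open Summit.HodgeConjecture.HodgeConjecture.Cruxes.H413.F0P3cDyRamValueClassLabelEquivariant (isTorusEquivariantLabel_valueClassLabel)
open Summit.HodgeConjecture.HodgeConjecture.Cruxes.H413.F0P3cDyRamLabelledOddOneSlotRead (map_unitNormMap_unitStabilizer_le)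
open Summit.HodgeConjecture.HodgeConjecture.Cruxes.H413.F0P3cDyRamLabelledOddClassSignRead (classSign_mul_eq_of_label)
open Summit.HodgeConjecture.HodgeConjecture.Cruxes.H413.F0P3cDyRamLabelledOddCharacterRead (labelledOddCount_div_relIndex_eq_of_character)
open Summit.HodgeConjecture.HodgeConjecture.Cruxes.H413.F0P3cDyRamDiagonalKappaSplitCountValues
open Summit.HodgeConjecture.HodgeConjecture.Cruxes.H413.F0P3cDyRamDiagonalKappaSplitCountEval (normSign_mul_self)
open scoped Valued WithZero Matrix MatrixGroups

variable {K : Type} [Field K] [Valued K ℤᵐ⁰] [CompleteSpace K] [Fintype 𝓀[K]] {σ : K →+* K} {ϖ : K} {d t : ℕ} {α β : K} {N₀ n₁ n₂ n₃ : ℕ}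

/-! ## §1  HEAD — the per-orbit value on `latt V(1,1,g)` at the κ-locus, indicator left abstract -/

open Classical in
/-- **THE LABELLED ODD VALUE OF THE κ-LOCUS GLUED REPRESENTATIVE, ABSTRACT-INDICATOR FORM (R6a FILE B).**  `V = V(1,1,g)` (`ρ, t′ ≥ 1`, `g` fixed, `|g| = |ϖ|^{2t′}`), `latt V` normalised,
`T`-stable, on the clean shell of `X = diag(α−1, β−1, 0)`, finite 𝒰-orbit; κ-locus `2ρ + ℓ₀ = n₂`, below the read `2(ρ+t′+k) + ℓ₀ = n₁` (`k ≥ 1`); unit tokens `e_A` (of `α − 1` at `ρ`) and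
`e_B` (of `β − 1` at `ρ+t′+k`); `r := e_B·π₀^{t′+k}∕(g·e_A)`, `c := r∕(1+r)`.  Then for every slot `i`,
`labelledOddCount σ ϖ 0 i Λ (latt V) ∕ [𝒰 : N(S̃′(latt V))] = ω(g·e_A·(1+r)) · ω(D(g)_i) ∕ 2 · [∀ u ∈ S_F(latt V), ω(u_i)·(ω(u₀)·ω(1 + (u₁∕u₀ − 1)·c)) = 1] · stabiliserWeight σ (latt V)`,
`D(g) = π₀^{−(ρ+t′)}·(g, 1, −(1+g)⁻¹)` (★ κG-A1) — ★ p861456 on the character `μ_c` (★ p861745 FILE A; multiplicative by ★ `normSign_one_add_mul_mul`; trivial on `N(S̃′)` by equivariance).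
[cite: Kottwitz1986BaseChangeUnits, §1 pp. 240–241] [cite: LanglandsShelstad1987, §3] [cite: Serre1979, Ch. V §3 Cor. 3; Ch. XV §2] [cite: Rogawski1990, §4.9 Prop. 4.9.1 (a)(b) p. 55, §4.10 p. 58] -/
theorem labelledOddCount_div_relIndex_glued_rep_kappaLocus (hD : IsRamifiedQuadraticDatum σ ϖ d t) (h2d : 2 ≤ d)
    (hE : IsElementDatum σ ϖ N₀ α β n₁ n₂ n₃) (hmc : mcOfRecord d ≤ N₀)
    {T : GL (Fin 3) K} (hT : (T : Matrix (Fin 3) (Fin 3) K) = Matrix.diagonal ![α, β, 1])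
    {ρ t' : ℕ} (hρ : 1 ≤ ρ) (ht' : 1 ≤ t') {g : K} (hσg : σ g = g) (hg : Valued.v g = Valued.v ϖ ^ (2 * t'))
    (V : GL (Fin 3) K) (hV : (V : Matrix (Fin 3) (Fin 3) K) = !![1, 0, 0; 1, ϖ ^ ρ, 0; 1 * 1 + g, ϖ ^ ρ * 1, ϖ ^ (2 * ρ + 2 * t')])
    (hn : IsNormalisedLattice (latt (V : Matrix (Fin 3) (Fin 3) K)))
    (hTM : mapGL T (latt (V : Matrix (Fin 3) (Fin 3) K)) = latt (V : Matrix (Fin 3) (Fin 3) K))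
    (hlev : LatticeInLevel ϖ (d % 2) (Matrix.diagonal ![α - 1, β - 1, 0]) (latt (V : Matrix (Fin 3) (Fin 3) K)))
    (hnlev : ¬ LatticeInLevel ϖ (d % 2 + 1) (Matrix.diagonal ![α - 1, β - 1, 0]) (latt (V : Matrix (Fin 3) (Fin 3) K)))
    (hsq : LatticeInLevel ϖ (mcOfRecord d) (Matrix.diagonal ![(α - 1) * (α - 1), (β - 1) * (β - 1), 0]) (latt (V : Matrix (Fin 3) (Fin 3) K)))
    (hfin : {M : Submodule 𝒪[K] (Fin 3 → K) | ∃ u ∈ unitTorus K 3, M = mapGL (diagGLUnits u) (latt (V : Matrix (Fin 3) (Fin 3) K))}.Finite)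
    (hκ : 2 * ρ + d % 2 = n₂) (k : ℕ) (hk : 1 ≤ k) (hk₁ : 2 * (ρ + t' + k) + d % 2 = n₁)
    {eA : K} (hσeA : σ eA = eA) (heA1 : Valued.v eA = 1)
    (heA : Valued.v ((ϖ ^ (d % 2 + 2 * d - 1))⁻¹ * ((α - 1) * ((ϖ * σ ϖ) ^ ρ)⁻¹ - eA * ((ϖ - σ ϖ) * ((ϖ * σ ϖ) ^ ((d - d % 2) / 2))⁻¹))) ≤ 1)
    {eB : K} (hσeB : σ eB = eB) (heB1 : Valued.v eB = 1)
    (heB : Valued.v ((ϖ ^ (d % 2 + 2 * d - 1))⁻¹ * ((β - 1) * ((ϖ * σ ϖ) ^ (ρ + t' + k))⁻¹ - eB * ((ϖ - σ ϖ) * ((ϖ * σ ϖ) ^ ((d - d % 2) / 2))⁻¹))) ≤ 1)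
    (i : Fin 3) :
    (labelledOddCount σ ϖ 0 i (valueClassLabel σ ϖ (α - 1) (β - 1) (d % 2 + 2 * d - 1) d) (latt (V : Matrix (Fin 3) (Fin 3) K)) : ℚ) /
        ((((unitStabilizer (latt (V : Matrix (Fin 3) (Fin 3) K))).map (unitNormMap σ 3)).relIndex (fixedUnitTorus σ 3) : ℕ) : ℚ) =
      (normSign σ (g * eA * (1 + eB * (ϖ * σ ϖ) ^ (t' + k) / (g * eA))) : ℚ) *
          (normSign σ ((![((ϖ * σ ϖ) ^ (ρ + t'))⁻¹ * g, ((ϖ * σ ϖ) ^ (ρ + t'))⁻¹, -(((ϖ * σ ϖ) ^ (ρ + t'))⁻¹ * (1 + g)⁻¹)] : Fin 3 → K) i) : ℚ) / 2 *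
        ((if ∀ u ∈ fixedUnitStabilizer σ (latt (V : Matrix (Fin 3) (Fin 3) K)),
              normSign σ ((u i : Kˣ) : K) *
                  (normSign σ ((u 0 : Kˣ) : K) *
                    normSign σ (1 + (((u 1 : Kˣ) : K) / ((u 0 : Kˣ) : K) - 1) *
                      ((eB * (ϖ * σ ϖ) ^ (t' + k) / (g * eA)) / (1 + eB * (ϖ * σ ϖ) ^ (t' + k) / (g * eA))))) = 1
            then 1 else 0 : ℤ) : ℚ) * stabiliserWeight σ (latt (V : Matrix (Fin 3) (Fin 3) K)) := by
  have hD' := hD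
  obtain ⟨hσ, hvσ, hϖ, -, -, hd1, -⟩ := hD'
  haveI : IsAdicComplete 𝓂[K] 𝒪[K] := isAdicComplete_valuedInteger_of_completeSpace hϖ
  haveI : Finite 𝓀[K] := Finite.of_fintype _
  obtain ⟨cn, hσcn, hcnv, hcn, hdich⟩ := exists_nonnorm_dichotomy_of_isRamifiedQuadraticDatum σ ϖ d t hD
  have hϖ0 : ϖ ≠ 0 := fun h0 => by rw [h0, map_zero] at hϖ; exact WithZero.coe_ne_zero hϖ.symm
  have hϖ1 : Valued.v ϖ < 1 := by rw [hϖ, ← WithZero.exp_zero, WithZero.exp_lt_exp]; norm_num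
  have hσϖ0 : σ ϖ ≠ 0 := (map_ne_zero σ).2 hϖ0
  have hq : ∀ n : ℕ, Valued.v ϖ ^ n = WithZero.exp (-(n : ℤ)) := fun n => v_varpi_pow hϖ n
  have hvπ : ∀ m : ℕ, Valued.v ((ϖ * σ ϖ) ^ m) = WithZero.exp (-((2 * m : ℕ) : ℤ)) := fun m => by
    rw [map_pow, map_mul, hvσ, ← pow_two, ← pow_mul, v_varpi_pow hϖ]
  have hπσ : ∀ m : ℕ, σ ((ϖ * σ ϖ) ^ m) = (ϖ * σ ϖ) ^ m := fun m => by rw [map_pow, map_mul, hσ, mul_comm]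
  have hπne : ∀ m : ℕ, ((ϖ * σ ϖ) ^ m : K) ≠ 0 := fun m => pow_ne_zero _ (mul_ne_zero hϖ0 hσϖ0)
  have hN₂ : N₀ ≤ n₂ := hE.2.2.2.2.2.2.2.2.2.1
  have hmcv : mcOfRecord d = 2 * ((d % 2 + 2 * d - 1 + d) / 2) := rfl
  have hg0 : g ≠ 0 := fun h => by
    rw [h, map_zero] at hg; exact (pow_ne_zero _ ((Valuation.ne_zero_iff _).2 hϖ0)) hg.symm
  have hg1 : Valued.v g < 1 := by rw [hg]; exact pow_lt_one₀ zero_le hϖ1 (by omega)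
  have h1g : Valued.v (1 + g) = 1 := Valued.v.map_one_add_of_lt hg1
  have h1g0 : 1 + g ≠ 0 := fun h => by rw [h, map_zero] at h1g; exact zero_ne_one h1g
  have heA0 : eA ≠ 0 := fun h => by rw [h, map_zero] at heA1; exact zero_ne_one heA1
  -- the polarisation `D(g)` (★ κG-A1), its fixedness, the fibre
  set D₁ : Fin 3 → K := ![((ϖ * σ ϖ) ^ (ρ + t'))⁻¹ * g, ((ϖ * σ ϖ) ^ (ρ + t'))⁻¹, -(((ϖ * σ ϖ) ^ (ρ + t'))⁻¹ * (1 + g)⁻¹)] with hD₁def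
  have hV₁ : IsVertexLattice σ ϖ (Matrix.diagonal D₁) 0 (latt (V : Matrix (Fin 3) (Fin 3) K)) :=
    isVertexLattice_zero_latt_glued_rep hσ hvσ hϖ0 hϖ1 ρ t' hσg hg ht' V hV
  have hD₁ : ∀ j, σ (D₁ j) = D₁ j ∧ D₁ j ≠ 0 := by
    intro j
    fin_cases j
    · show σ (D₁ 0) = D₁ 0 ∧ D₁ 0 ≠ 0
      exact ⟨by rw [show D₁ 0 = ((ϖ * σ ϖ) ^ (ρ + t'))⁻¹ * g from rfl, map_mul, map_inv₀, hπσ, hσg], mul_ne_zero (inv_ne_zero (hπne _)) hg0⟩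
    · show σ (D₁ 1) = D₁ 1 ∧ D₁ 1 ≠ 0
      exact ⟨by rw [show D₁ 1 = ((ϖ * σ ϖ) ^ (ρ + t'))⁻¹ from rfl, map_inv₀, hπσ], by rw [show D₁ 1 = ((ϖ * σ ϖ) ^ (ρ + t'))⁻¹ from rfl]; exact inv_ne_zero (hπne _)⟩
    · show σ (D₁ 2) = D₁ 2 ∧ D₁ 2 ≠ 0
      exact ⟨by rw [show D₁ 2 = -(((ϖ * σ ϖ) ^ (ρ + t'))⁻¹ * (1 + g)⁻¹) from rfl, map_neg, map_mul, map_inv₀, map_inv₀, hπσ, map_add, map_one, hσg],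
        by rw [show D₁ 2 = -(((ϖ * σ ϖ) ^ (ρ + t'))⁻¹ * (1 + g)⁻¹) from rfl]; exact neg_ne_zero.2 (mul_ne_zero (inv_ne_zero (hπne _)) (inv_ne_zero h1g0))⟩
  have hcoset : ∀ D : Fin 3 → K, (∀ j, σ (D j) = D j ∧ D j ≠ 0) →
      (IsVertexLattice σ ϖ (Matrix.diagonal D) 0 (latt (V : Matrix (Fin 3) (Fin 3) K)) ↔
        ∃ u ∈ fixedUnitStabilizer σ (latt (V : Matrix (Fin 3) (Fin 3) K)), ∀ j, D j = D₁ j * ((u j : Kˣ) : K)) :=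
    fun D hDD => fibre_isCoset_zero hvσ ϖ V rfl hn D₁ hD₁ hV₁ D hDD
  -- `r`, `c = r∕(1+r)` and their letters
  set r : K := eB * (ϖ * σ ϖ) ^ (t' + k) / (g * eA) with hrdef
  set c : K := r / (1 + r) with hcdef
  have hσr : σ r = r := by rw [hrdef, map_div₀, map_mul, map_mul, hσeB, hπσ, hσg, hσeA]
  have hvr : Valued.v r = Valued.v ϖ ^ (2 * k) := by
    rw [hrdef, map_div₀, map_mul, map_mul, heB1, one_mul, hvπ, hg, heA1, mul_one, hq, hq, ← WithZero.exp_sub]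
    congr 1; push_cast; ring
  have hrlt : Valued.v r < 1 := by rw [hvr]; exact pow_lt_one₀ zero_le hϖ1 (by omega)
  have h1r : Valued.v (1 + r) = 1 := Valued.v.map_one_add_of_lt hrlt
  have hσc : σ c = c := by rw [hcdef, map_div₀, hσr, map_add, map_one, hσr]
  have hcv : Valued.v c = Valued.v ϖ ^ (2 * k) := by rw [hcdef, map_div₀, h1r, div_one, hvr]
  -- on `S_F(latt V)`: fixed units with `|u₁∕u₀ − 1| ≤ |ϖ|^ρ`
  have hSF : ∀ u ∈ fixedUnitStabilizer σ (latt (V : Matrix (Fin 3) (Fin 3) K)),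
      u ∈ fixedUnitTorus σ 3 ∧ (∀ j, σ ((u j : Kˣ) : K) = (u j : Kˣ)) ∧ Valued.v (((u 1 : Kˣ) : K) / ((u 0 : Kˣ) : K) - 1) ≤ Valued.v (ϖ ^ ρ) := by
    intro u hu
    obtain ⟨-, huv, huσ⟩ := (mem_fixedUnitStabilizer_iff σ _ u).1 hu
    have hv := (ratios_of_mem_fixedUnitStabilizer_glued_rep (σ := σ) hϖ0 hϖ1 ht' hg V hV hu).1
    refine ⟨(mem_fixedUnitTorus_iff σ u).2 ⟨huv, huσ⟩, huσ, ?_⟩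
    have h01 : Valued.v (((u 0 : Kˣ) : K) / ((u 1 : Kˣ) : K)) = 1 := by rw [map_div₀, huv, huv, div_one]
    rw [show ((u 1 : Kˣ) : K) / ((u 0 : Kˣ) : K) - 1 = -((((u 0 : Kˣ) : K) / ((u 1 : Kˣ) : K) - 1) / (((u 0 : Kˣ) : K) / ((u 1 : Kˣ) : K))) by
        field_simp; ring, Valuation.map_neg, map_div₀, h01, div_one, map_pow]
    exact hv
  -- ★ `normSign_one_add_mul_mul`'s letters at depth `ρ`: `|ϖ^ρ|·|c| < 1`, `|ϖ^ρ|²·|c|·max(|c|,1) = |ϖ|^{2ρ+2k} ≤ |ϖ|^{2d−1}`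
  have hsmall : Valued.v (ϖ ^ ρ) * Valued.v c < 1 := by
    rw [map_pow, hcv, ← pow_add]; exact pow_lt_one₀ zero_le hϖ1 (by omega)
  have hdepth : Valued.v (ϖ ^ ρ) * Valued.v (ϖ ^ ρ) * Valued.v c * max (Valued.v c) 1 ≤ Valued.v ϖ ^ (2 * d - 1) := by
    have hc1 : Valued.v c ≤ 1 := by rw [hcv]; exact pow_le_one₀ zero_le hϖ1.le
    rw [max_eq_right hc1, mul_one, map_pow, hcv, ← pow_add, ← pow_add, hq, hq, WithZero.exp_le_exp]
    rw [hmcv] at hmc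
    push_cast; omega
  -- THE CHARACTER `μ(u) = ω(u₀)·ω(1 + (u₁∕u₀ − 1)·c)` and the ORBIT SIGN `ε = ω(g·e_A·(1+r))`
  set ε : ℤ := normSign σ (g * eA * (1 + r)) with hεdef
  have hε : ε = 1 ∨ ε = -1 := normSign_eq_one_or σ _
  have hval : ∀ u ∈ fixedUnitStabilizer σ (latt (V : Matrix (Fin 3) (Fin 3) K)),
      normSign σ ((u 0 : Kˣ) : K) * normSign σ (1 + (((u 1 : Kˣ) : K) / ((u 0 : Kˣ) : K) - 1) * c) = 1 ∨
        normSign σ ((u 0 : Kˣ) : K) * normSign σ (1 + (((u 1 : Kˣ) : K) / ((u 0 : Kˣ) : K) - 1) * c) = -1 := by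
    intro u _
    rcases normSign_eq_one_or σ ((u 0 : Kˣ) : K) with h0 | h0 <;>
      rcases normSign_eq_one_or σ (1 + (((u 1 : Kˣ) : K) / ((u 0 : Kˣ) : K) - 1) * c) with h1 | h1 <;> simp [h0, h1]
  have hΛ : ∀ u ∈ fixedUnitStabilizer σ (latt (V : Matrix (Fin 3) (Fin 3) K)),
      valueClassLabel σ ϖ (α - 1) (β - 1) (d % 2 + 2 * d - 1) d (latt (V : Matrix (Fin 3) (Fin 3) K)) (fun j => D₁ j * ((u j : Kˣ) : K)) ↔
        ε * (normSign σ ((u 0 : Kˣ) : K) * normSign σ (1 + (((u 1 : Kˣ) : K) / ((u 0 : Kˣ) : K) - 1) * c)) = 1 := by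
    intro u hu
    obtain ⟨huT, huσ, h10⟩ := hSF u hu
    have hM : IsVertexLattice σ ϖ (Matrix.diagonal fun j => D₁ j * ((u j : Kˣ) : K)) 0 (latt (V : Matrix (Fin 3) (Fin 3) K)) :=
      (hcoset _ fun j => ⟨by rw [map_mul, (hD₁ j).1, huσ j], mul_ne_zero (hD₁ j).2 (u j).ne_zero⟩).2 ⟨u, hu, fun j => rfl⟩
    have h := valueClassLabel_glued_rep_class_kappaLocus_iff_character hD h2d hρ ht' hσg hg V hV huT (by rw [map_pow] at h10; exact h10) hn hM hE hmc
      hlev hnlev hsq hT hTM hκ k hk hk₁ hσeA heA1 heA hσeB heB1 heB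
    rw [h, hεdef, hcdef, hrdef, mul_comm (((u 1 : Kˣ) : K) / ((u 0 : Kˣ) : K) - 1)]
  have hmul : ∀ u ∈ fixedUnitStabilizer σ (latt (V : Matrix (Fin 3) (Fin 3) K)), ∀ u' ∈ fixedUnitStabilizer σ (latt (V : Matrix (Fin 3) (Fin 3) K)),
      normSign σ (((u * u') 0 : Kˣ) : K) * normSign σ (1 + ((((u * u') 1 : Kˣ) : K) / (((u * u') 0 : Kˣ) : K) - 1) * c) =
        (normSign σ ((u 0 : Kˣ) : K) * normSign σ (1 + (((u 1 : Kˣ) : K) / ((u 0 : Kˣ) : K) - 1) * c)) *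
          (normSign σ ((u' 0 : Kˣ) : K) * normSign σ (1 + (((u' 1 : Kˣ) : K) / ((u' 0 : Kˣ) : K) - 1) * c)) := by
    intro u hu u' hu'
    obtain ⟨-, huσ, h10⟩ := hSF u hu
    obtain ⟨-, huσ', h10'⟩ := hSF u' hu'
    have e0 : (((u * u') 0 : Kˣ) : K) = ((u 0 : Kˣ) : K) * ((u' 0 : Kˣ) : K) := by rw [Pi.mul_apply, Units.val_mul]
    have e1 : (((u * u') 1 : Kˣ) : K) / (((u * u') 0 : Kˣ) : K) = (((u 1 : Kˣ) : K) / ((u 0 : Kˣ) : K)) * (((u' 1 : Kˣ) : K) / ((u' 0 : Kˣ) : K)) := by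
      rw [Pi.mul_apply, Pi.mul_apply, Units.val_mul, Units.val_mul]; field_simp
    have hσt : σ (((u 1 : Kˣ) : K) / ((u 0 : Kˣ) : K)) = ((u 1 : Kˣ) : K) / ((u 0 : Kˣ) : K) := by rw [map_div₀, huσ 1, huσ 0]
    have hσt' : σ (((u' 1 : Kˣ) : K) / ((u' 0 : Kˣ) : K)) = ((u' 1 : Kˣ) : K) / ((u' 0 : Kˣ) : K) := by rw [map_div₀, huσ' 1, huσ' 0]
    rw [e1, e0, normSign_mul_of_fixed hD (huσ 0) (huσ' 0) (u 0).ne_zero (u' 0).ne_zero,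
      normSign_one_add_mul_mul hD hσc (r := ρ) hρ hsmall hdepth hσt hσt' h10 h10']
    ring
  -- `N′ ≤ S_F` and `μ ≡ 1` on `N′` (torus-equivariance of the value-class label; the ★ (β1) argument verbatim)
  have hNS := map_unitNormMap_unitStabilizer_le σ hσ ϖ 0 hD₁ hV₁ hcoset
  have hone : normSign σ (1 : K) = 1 := normSign_of_isNorm σ ⟨1, by rw [map_one, one_mul]⟩
  have hval' : ∀ u ∈ fixedUnitStabilizer σ (latt (V : Matrix (Fin 3) (Fin 3) K)),
      ε * (normSign σ ((u 0 : Kˣ) : K) * normSign σ (1 + (((u 1 : Kˣ) : K) / ((u 0 : Kˣ) : K) - 1) * c)) = 1 ∨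
        ε * (normSign σ ((u 0 : Kˣ) : K) * normSign σ (1 + (((u 1 : Kˣ) : K) / ((u 0 : Kˣ) : K) - 1) * c)) = -1 := by
    intro u hu
    rcases hε with h0 | h0 <;> rcases hval u hu with h1 | h1 <;> simp [h0, h1]
  have hN : ∀ n ∈ (unitStabilizer (latt (V : Matrix (Fin 3) (Fin 3) K))).map (unitNormMap σ 3),
      normSign σ ((n 0 : Kˣ) : K) * normSign σ (1 + (((n 1 : Kˣ) : K) / ((n 0 : Kˣ) : K) - 1) * c) = 1 := by
    intro n hn'
    have key := classSign_mul_eq_of_label (D₁ := D₁) (isTorusEquivariantLabel_valueClassLabel σ ϖ (α - 1) (β - 1) (d % 2 + 2 * d - 1) d) hNS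
      (lam := fun u => ε * (normSign σ ((u 0 : Kˣ) : K) * normSign σ (1 + (((u 1 : Kˣ) : K) / ((u 0 : Kˣ) : K) - 1) * c)))
      hval' hΛ (one_mem _) hn'
    have h1 : normSign σ (((1 : Fin 3 → Kˣ) 0 : Kˣ) : K) * normSign σ (1 + ((((1 : Fin 3 → Kˣ) 1 : Kˣ) : K) / (((1 : Fin 3 → Kˣ) 0 : Kˣ) : K) - 1) * c) = 1 := by
      simp only [Pi.one_apply, Units.val_one, div_one, sub_self, zero_mul, add_zero, hone, mul_one]
    simp only [one_mul] at key
    rw [h1, mul_one] at key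
    rcases hε with h0 | h0
    · rw [h0, one_mul] at key; exact key
    · rw [h0, neg_one_mul, neg_eq_iff_eq_neg] at key
      rcases hval n (hNS hn') with h | h
      · exact h
      · rw [h] at key; norm_num at key
  have hfinal := labelledOddCount_div_relIndex_eq_of_character hσ hvσ hσcn hcnv hcn hdich hfin hD₁ hV₁ hcoset
    (valueClassLabel σ ϖ (α - 1) (β - 1) (d % 2 + 2 * d - 1) d) i hε hmul hval hN hΛ
  rw [hfinal]

/-! ## §2  The indicators of slots `0` and `1`, by the involution `u ↦ u⁻¹` of `S_F` and ★ LH4-p17's R3 FILE 3 -/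

/-- **SLOT `0` (the own slot of tower 1): `[∀ u ∈ S_F(latt V), ω(u₀)·μ_c(u) = 1] ↔ 2d ≤ ρ + k + 1`** for `c` fixed with `|c| = |ϖ|^k` EXACTLY (`k ≥ 1`; `|2| < 1` for the killer):
`ω(u₀)² = 1` leaves `ω(1 + (u₁∕u₀ − 1)·c)`, and `u ↦ u⁻¹` (an involution of `S_F` with `(u⁻¹)₁∕(u⁻¹)₀ = u₀∕u₁`) turns it into ★ `forall_normSign_one_mul_gluedChar_iff`'s
`ω(1 + c·(u₀∕u₁ − 1))`. [cite: Serre1979, Ch. V §3 Prop. 5, Cor. 3; Ch. XV §2] [cite: LanglandsShelstad1987, §3] -/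
theorem forall_normSign_zero_mul_kappaChar_iff (hD : IsRamifiedQuadraticDatum σ ϖ d t) (h2 : Valued.v (2 : K) < 1) {ρ t' : ℕ} (hρ : 1 ≤ ρ) (ht' : 1 ≤ t')
    {g : K} (hσg : σ g = g) (hg : Valued.v g = Valued.v ϖ ^ (2 * t'))
    (V : GL (Fin 3) K) (hV : (V : Matrix (Fin 3) (Fin 3) K) = !![1, 0, 0; 1, ϖ ^ ρ, 0; 1 * 1 + g, ϖ ^ ρ * 1, ϖ ^ (2 * ρ + 2 * t')])
    {c : K} (hσc : σ c = c) {k : ℕ} (hk : 1 ≤ k) (hck : Valued.v c = Valued.v ϖ ^ k) :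
    (∀ u ∈ fixedUnitStabilizer σ (latt (V : Matrix (Fin 3) (Fin 3) K)),
        normSign σ ((u 0 : Kˣ) : K) * (normSign σ ((u 0 : Kˣ) : K) * normSign σ (1 + (((u 1 : Kˣ) : K) / ((u 0 : Kˣ) : K) - 1) * c)) = 1) ↔
      2 * d ≤ ρ + k + 1 := by
  haveI : Finite 𝓀[K] := Finite.of_fintype _
  rw [← forall_normSign_one_mul_gluedChar_iff hD h2 hρ ht' hσg hg V hV hσc hk hck]
  have hsq0 : ∀ u : Fin 3 → Kˣ, ∀ x : ℤ, normSign σ ((u 0 : Kˣ) : K) * (normSign σ ((u 0 : Kˣ) : K) * x) = x := fun u x => by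
    rw [← mul_assoc, normSign_mul_self, one_mul]
  have hsq1 : ∀ u : Fin 3 → Kˣ, ∀ x : ℤ, normSign σ ((u 1 : Kˣ) : K) * (normSign σ ((u 1 : Kˣ) : K) * x) = x := fun u x => by
    rw [← mul_assoc, normSign_mul_self, one_mul]
  have hinv : ∀ u : Fin 3 → Kˣ, (((u⁻¹ : Fin 3 → Kˣ) 1 : Kˣ) : K) / (((u⁻¹ : Fin 3 → Kˣ) 0 : Kˣ) : K) = ((u 0 : Kˣ) : K) / ((u 1 : Kˣ) : K) := fun u => by
    rw [Pi.inv_apply, Pi.inv_apply, Units.val_inv_eq_inv_val, Units.val_inv_eq_inv_val, inv_div_inv]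
  have hinv' : ∀ u : Fin 3 → Kˣ, (((u⁻¹ : Fin 3 → Kˣ) 0 : Kˣ) : K) / (((u⁻¹ : Fin 3 → Kˣ) 1 : Kˣ) : K) = ((u 1 : Kˣ) : K) / ((u 0 : Kˣ) : K) := fun u => by
    rw [Pi.inv_apply, Pi.inv_apply, Units.val_inv_eq_inv_val, Units.val_inv_eq_inv_val, inv_div_inv]
  constructor
  · intro h u hu
    have h' := h u⁻¹ (inv_mem hu)
    rw [hsq0, hinv, mul_comm _ c] at h'
    rw [hsq1]
    exact h'
  · intro h u hu
    have h' := h u⁻¹ (inv_mem hu)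
    rw [hsq1, hinv', mul_comm c] at h'
    rw [hsq0]
    exact h'

/-- **SLOT `1`: `[∀ u ∈ S_F(latt V), ω(u₁)·μ_c(u) = 1] ↔ 2d ≤ ρ + 1`** for `c` fixed with `|c| ≤ |ϖ|^k` (`k ≥ 1`; `|2| < 1` for the killer): under `u ↦ u⁻¹` (`ω(x⁻¹) = ω(x)` on fixed units)
`ω(u₁)ω(u₀)ω(1 + (u₁∕u₀ − 1)·c)` becomes ★ `forall_normSign_zero_mul_gluedChar_iff`'s `ω(u₀)·(ω(u₁)·ω(1 + c·(u₀∕u₁ − 1)))`.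
[cite: Serre1979, Ch. V §3 Prop. 5, Cor. 3; Ch. XV §2] [cite: LanglandsShelstad1987, §3] -/
theorem forall_normSign_one_mul_kappaChar_iff (hD : IsRamifiedQuadraticDatum σ ϖ d t) (h2 : Valued.v (2 : K) < 1) {ρ t' : ℕ} (hρ : 1 ≤ ρ) (ht' : 1 ≤ t')
    {g : K} (hσg : σ g = g) (hg : Valued.v g = Valued.v ϖ ^ (2 * t'))
    (V : GL (Fin 3) K) (hV : (V : Matrix (Fin 3) (Fin 3) K) = !![1, 0, 0; 1, ϖ ^ ρ, 0; 1 * 1 + g, ϖ ^ ρ * 1, ϖ ^ (2 * ρ + 2 * t')])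
    {c : K} (hσc : σ c = c) {k : ℕ} (hk : 1 ≤ k) (hck : Valued.v c ≤ Valued.v ϖ ^ k) :
    (∀ u ∈ fixedUnitStabilizer σ (latt (V : Matrix (Fin 3) (Fin 3) K)),
        normSign σ ((u 1 : Kˣ) : K) * (normSign σ ((u 0 : Kˣ) : K) * normSign σ (1 + (((u 1 : Kˣ) : K) / ((u 0 : Kˣ) : K) - 1) * c)) = 1) ↔
      2 * d ≤ ρ + 1 := by
  haveI : Finite 𝓀[K] := Finite.of_fintype _
  rw [← forall_normSign_zero_mul_gluedChar_iff hD h2 hρ ht' hσg hg V hV hσc hk hck]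
  have hωinv : ∀ u ∈ fixedUnitStabilizer σ (latt (V : Matrix (Fin 3) (Fin 3) K)), ∀ j : Fin 3,
      normSign σ (((u⁻¹ : Fin 3 → Kˣ) j : Kˣ) : K) = normSign σ ((u j : Kˣ) : K) := fun u hu j => by
    obtain ⟨-, -, huσ⟩ := (mem_fixedUnitStabilizer_iff σ _ u).1 hu
    rw [Pi.inv_apply, Units.val_inv_eq_inv_val, normSign_inv_of_map_eq σ (huσ j) (u j).ne_zero]
  have hinv : ∀ u : Fin 3 → Kˣ, (((u⁻¹ : Fin 3 → Kˣ) 1 : Kˣ) : K) / (((u⁻¹ : Fin 3 → Kˣ) 0 : Kˣ) : K) = ((u 0 : Kˣ) : K) / ((u 1 : Kˣ) : K) := fun u => by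
    rw [Pi.inv_apply, Pi.inv_apply, Units.val_inv_eq_inv_val, Units.val_inv_eq_inv_val, inv_div_inv]
  have hinv' : ∀ u : Fin 3 → Kˣ, (((u⁻¹ : Fin 3 → Kˣ) 0 : Kˣ) : K) / (((u⁻¹ : Fin 3 → Kˣ) 1 : Kˣ) : K) = ((u 1 : Kˣ) : K) / ((u 0 : Kˣ) : K) := fun u => by
    rw [Pi.inv_apply, Pi.inv_apply, Units.val_inv_eq_inv_val, Units.val_inv_eq_inv_val, inv_div_inv]
  constructor
  · intro h u hu
    have h' := h u⁻¹ (inv_mem hu)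
    rw [hωinv u hu 1, hωinv u hu 0, hinv, mul_comm _ c, ← mul_assoc, mul_comm (normSign σ ((u 1 : Kˣ) : K)) (normSign σ ((u 0 : Kˣ) : K)), mul_assoc] at h'
    exact h'
  · intro h u hu
    have h' := h u⁻¹ (inv_mem hu)
    rw [hωinv u hu 0, hωinv u hu 1, hinv', mul_comm c, ← mul_assoc, mul_comm (normSign σ ((u 0 : Kˣ) : K)) (normSign σ ((u 1 : Kˣ) : K)), mul_assoc] at h'
    exact h'

end Summit.HodgeConjecture.HodgeConjecture.Cruxes.H413.F0P3cDyRamLabelledOddKappaClassValueG1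

end
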